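import Mathlib
import Summits.MatrixMultiplication.MatrixMultiplication.Theses.MatrixPointInterpolation

/-!
# `MatrixPointInterpolation.TightWindows` (stmt-MatrixMultiplication-18939) — Negative lane:
# the five-point corner pair, part 1: the pair `(N, E_{1n})`, gap law and generation

Helper (no Theses conclusion, no new definition) for the unconditional refutation
`MatrixPointInterpolationTightWindows_refuted` and, verbatim, for the positive crux
`LongMasquerade` (stmt-MatrixMultiplication-18938, a prover's landing): `corner_pair_exists`.

The corner pair of size `m + 1`: `N` the subdiagonal nilpotent shift (`N e_j = e_{j+1}`) and
`E = E_{1n}` the corner matrix unit.  Both are partial-permutation matrices, so a word `w` acts on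
column indices by a partial map `run w` (`N : c ↦ c + 1`, `E : m ↦ 0`; rightmost letter first)
and `w(A)_{i,c} = [run w c = i]`.  A defined run obeys the counting invariant
`|w| + c = #E(w)·(m+1) + (final index)` — the gap law `E N^a E = [a = m] E` in closed form —
whence every word with `≥ k ≥ 1` letters `E` and length `≤ (k-1)(m+1)` vanishes at the pair.
Generation in degree `2(m+1)`: `N^p E N^{m-q} = E_{pq}`.
-/

namespace Summit.MatrixMultiplication.MatrixMultiplication.Theorems

namespace TightWindowsNeg

open scoped BigOperators

/-- **The corner pair.** For every `m` there is a pair `A ∈ M_{m+1}(ℂ)²` (namely `(N, E_{1n})`)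
whose words of length `≤ 2(m+1)` span `M_{m+1}(ℂ)` and at which every word with at least
`k ≥ 1` letters `1` and length `≤ (k-1)(m+1)` vanishes (gap law). [folklore] -/
theorem corner_pair_exists (m : ℕ) :
    ∃ A : Fin 2 → Matrix (Fin (m + 1)) (Fin (m + 1)) ℂ,
      Submodule.span ℂ {M : Matrix (Fin (m + 1)) (Fin (m + 1)) ℂ |
        ∃ w : List (Fin 2), w.length ≤ 2 * (m + 1) ∧ (w.map A).prod = M} = ⊤ ∧
      ∀ (k : ℕ) (w : List (Fin 2)), 1 ≤ k → k ≤ w.count 1 → w.length ≤ (k - 1) * (m + 1) →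
        (w.map A).prod = 0 := by
  classical
  -- the objects
  let A : Fin 2 → Matrix (Fin (m + 1)) (Fin (m + 1)) ℂ :=
    ![Matrix.of fun i j => if (i : ℕ) = (j : ℕ) + 1 then 1 else 0,
      Matrix.of fun i j => if (i : ℕ) = 0 ∧ (j : ℕ) = m then 1 else 0]
  let step : Fin 2 → Fin (m + 1) → Option (Fin (m + 1)) := fun l c =>
    if l = 0 then (if h : (c : ℕ) < m then some ⟨(c : ℕ) + 1, Nat.succ_lt_succ h⟩ else none)
    else (if (c : ℕ) = m then some 0 else none)
  let run : List (Fin 2) → Fin (m + 1) → Option (Fin (m + 1)) := fun w c =>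
    w.foldr (fun l acc => acc.bind (step l)) (some c)
  have run_nil : ∀ c, run [] c = some c := fun c => rfl
  have run_cons : ∀ l w c, run (l :: w) c = (run w c).bind (step l) := fun l w c => rfl
  have step_zero : ∀ c : Fin (m + 1), step 0 c =
      if h : (c : ℕ) < m then some ⟨(c : ℕ) + 1, Nat.succ_lt_succ h⟩ else none := fun c => rfl
  have step_one : ∀ c : Fin (m + 1), step 1 c = if (c : ℕ) = m then some 0 else none :=
    fun c => rfl
  -- entries of the two letters
  have A_apply : ∀ (l : Fin 2) (i c : Fin (m + 1)), A l i c = if step l c = some i then 1 else 0 := by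
    intro l i c
    have hi := i.is_lt
    have hc := c.is_lt
    obtain rfl | rfl : l = 0 ∨ l = 1 := by fin_cases l <;> simp
    · rw [step_zero]
      simp only [A, Fin.isValue, Matrix.cons_val_zero, Matrix.of_apply]
      by_cases h : (c : ℕ) < m
      · rw [dif_pos h]
        simp only [Option.some.injEq, Fin.ext_iff]
        simp only [eq_comm]
      · rw [dif_neg h]
        simp only [reduceCtorEq, if_false, ite_eq_right_iff, one_ne_zero, imp_false]
        omega
    · rw [step_one]
      simp only [A, Fin.isValue, Matrix.cons_val_one, Matrix.cons_val_fin_one, Matrix.of_apply]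
      by_cases h : (c : ℕ) = m
      · simp only [h, and_true, if_true, Option.some.injEq]
        by_cases h' : (i : ℕ) = 0
        · have : (0 : Fin (m + 1)) = i := Fin.ext (by simp [h'])
          simp [h', this]
        · have : (0 : Fin (m + 1)) ≠ i := fun e => h' (by rw [← e]; simp)
          simp [h', this]
      · simp [h]
  -- entries of words: partial-map semantics
  have prod_apply : ∀ (w : List (Fin 2)) (i c : Fin (m + 1)),
      (w.map A).prod i c = if run w c = some i then 1 else 0 := by
    intro w
    induction w with
    | nil =>
      intro i c
      rw [run_nil]
      simp only [List.map_nil, List.prod_nil, Option.some.injEq, Matrix.one_apply]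
      by_cases h : i = c
      · simp [h]
      · have h' : c ≠ i := fun e => h e.symm
        simp [h, h']
    | cons l w ih =>
      intro i c
      rw [List.map_cons, List.prod_cons, Matrix.mul_apply, run_cons]
      simp only [ih, A_apply]
      obtain hnone | ⟨x, hx⟩ : run w c = none ∨ ∃ x, run w c = some x := by
        cases run w c with
        | none => exact Or.inl rfl
        | some x => exact Or.inr ⟨x, rfl⟩
      · simp [hnone]
      · simp only [hx, Option.bind_some, Option.some.injEq, mul_ite, mul_one, mul_zero]
        rw [Finset.sum_ite_eq]
        simp
  -- the counting invariant (gap law)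
  have run_count : ∀ (w : List (Fin 2)) (c i : Fin (m + 1)), run w c = some i →
      w.length + (c : ℕ) = w.count 1 * (m + 1) + i := by
    intro w
    induction w with
    | nil =>
      intro c i h
      rw [run_nil] at h
      simp only [Option.some.injEq] at h
      subst h
      simp
    | cons l w ih =>
      intro c i h
      rw [run_cons] at h
      cases h' : run w c with
      | none => rw [h'] at h; simp at h
      | some x =>
        rw [h'] at h
        simp only [Option.bind_some] at h
        have hx := ih c x h'
        fin_cases l
        · simp only [Fin.zero_eta, Fin.isValue] at h
          rw [step_zero] at h
          split_ifs at h with hlt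
          simp only [Option.some.injEq] at h
          have hi : (i : ℕ) = x + 1 := by rw [← h]
          simp only [List.length_cons, List.count_cons, Fin.isValue]
          simp
          omega
        · simp only [Fin.mk_one, Fin.isValue] at h
          rw [step_one] at h
          split_ifs at h with hxm
          simp only [Option.some.injEq] at h
          have hi : (i : ℕ) = 0 := by rw [← h]; simp
          simp only [List.length_cons, List.count_cons, Fin.isValue]
          simp [Nat.add_mul]
          omega
  -- `run` is anti-multiplicative
  have run_append : ∀ (u v : List (Fin 2)) (c : Fin (m + 1)),
      run (u ++ v) c = (run v c).bind fun x => run u x := by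
    intro u v c
    induction u with
    | nil =>
      rw [List.nil_append]
      cases run v c <;> rfl
    | cons l u ih =>
      rw [List.cons_append, run_cons, ih, Option.bind_assoc]
      rfl
  -- powers of `N`
  have run_replicate : ∀ (a : ℕ) (c : Fin (m + 1)), run (List.replicate a 0) c =
      if h : (c : ℕ) + a < m + 1 then some ⟨(c : ℕ) + a, h⟩ else none := by
    intro a c
    have hc := c.is_lt
    induction a with
    | zero =>
      rw [dif_pos (by omega)]
      rfl
    | succ a ih =>
      rw [List.replicate_succ, run_cons, ih]
      by_cases h : (c : ℕ) + a < m + 1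
      · rw [dif_pos h, Option.bind_some, step_zero]
        by_cases h' : (c : ℕ) + a < m
        · rw [dif_pos h', dif_pos (by omega)]
          rfl
        · rw [dif_neg h', dif_neg (by omega)]
      · rw [dif_neg h, dif_neg (by omega)]
        rfl
  -- the unit words `N^p E N^(m-q)`
  have run_unit : ∀ p q c : Fin (m + 1),
      run (List.replicate p (0 : Fin 2) ++ ((1 : Fin 2) :: List.replicate (m - q) 0)) c =
        if c = q then some p else none := by
    intro p q c
    have hp := p.is_lt
    have hq := q.is_lt
    have hc := c.is_lt
    rw [run_append]
    have h1 : run ((1 : Fin 2) :: List.replicate (m - q) 0) c = if c = q then some 0 else none := by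
      rw [run_cons, run_replicate]
      by_cases hcq : c = q
      · subst hcq
        rw [dif_pos (by omega), if_pos rfl, Option.bind_some, step_one, if_pos]
        dsimp only
        omega
      · rw [if_neg hcq]
        by_cases h : (c : ℕ) + (m - q) < m + 1
        · rw [dif_pos h, Option.bind_some, step_one, if_neg]
          dsimp only
          intro e
          exact hcq (Fin.ext (by omega))
        · rw [dif_neg h]
          rfl
    rw [h1]
    by_cases hcq : c = q
    · rw [if_pos hcq, if_pos hcq, Option.bind_some, run_replicate, dif_pos (by simp [hp])]
      simp
    · rw [if_neg hcq, if_neg hcq]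
      rfl
  have prod_unit : ∀ p q : Fin (m + 1),
      ((List.replicate p (0 : Fin 2) ++ ((1 : Fin 2) :: List.replicate (m - q) 0)).map A).prod =
        Matrix.single p q (1 : ℂ) := by
    intro p q
    ext i c
    rw [prod_apply, run_unit, Matrix.single_apply]
    by_cases hc : c = q
    · by_cases hp : p = i
      · simp [hc, hp]
      · simp [hc, hp]
    · have hc' : q ≠ c := fun e => hc e.symm
      simp [hc, hc']
  refine ⟨A, ?_, ?_⟩
  · -- generation
    rw [eq_top_iff]
    rintro M -
    rw [Matrix.matrix_eq_sum_single M]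
    refine Submodule.sum_mem _ fun i _ => Submodule.sum_mem _ fun j _ => ?_
    have : Matrix.single i j (M i j) = M i j • Matrix.single i j (1 : ℂ) := by
      rw [Matrix.smul_single, smul_eq_mul, mul_one]
    rw [this]
    refine Submodule.smul_mem _ _ (Submodule.subset_span ⟨_, ?_, prod_unit i j⟩)
    have := i.is_lt
    simp only [List.length_append, List.length_replicate, List.length_cons]
    omega
  · -- gap-law vanishing
    intro k w hk1 hk hlen
    ext i c
    rw [prod_apply, Matrix.zero_apply]
    split_ifs with h
    · exfalso
      have hrun := run_count w c i h
      have hc := c.is_lt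
      obtain ⟨k', rfl⟩ : ∃ k', k = k' + 1 := ⟨k - 1, by omega⟩
      simp only [Nat.add_sub_cancel] at hlen
      have h1 : (k' + 1) * (m + 1) ≤ w.count 1 * (m + 1) := Nat.mul_le_mul_right _ hk
      rw [Nat.add_mul, one_mul] at h1
      omega
    · rfl

end TightWindowsNeg

end Summit.MatrixMultiplication.MatrixMultiplication.Theorems
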